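import Summits.Ventures.YMGap.Census.CrossingWeightRP
import Literature.MathematicalPhysics.QuantumFieldTheory.ConstructiveQFTWave0OddRPProofs
import HarnessLib

/-!
# Venture YMGap, track (b) — reflection positivity with a character weight on the crossing plaquettes of the
# ODD torus ("planes with sites"): the algebra

HONEST FRAMING: venture file of the cell `pub-ymgap` (QuantumFields programme), track (b); finite-volume lattice
gauge theory only.  `CrossingWeightRP` / `CharacterTwistGram` treat the EVEN torus `(ℤ/Lℤ)^d`, where the
reflection `θ t = 1 - t` fixes two hyperplanes between time slices.  On the ODD torus (`L = 2m+1`, e.g. the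
census's `3³`) the same reflection fixes ONE hyperplane between the slices `0 | 1` and ONE hyperplane THROUGH
the sites of the slice `t = m + 1` — Tomboulis's "reflection positivity in planes with sites" (arXiv:0707.2179,
§2 after eq. (2.8): "`F_j ≥ 0`, `1 ≥ c_j ≥ 0` … implies … reflection positivity both in planes without sites and
in planes with sites").  The tree has this mixed geometry (`WilsonOddRP` of `ConstructiveQFTWave0OddRPProofs`:
positive / crossing / SHARED / negative plaquettes, the splitting `translateLow Y` of the crossing links
`t = 0 → 1`, the crossing identity `plaqRe_translateLow_of_isOCrossPlaq`) and the abstract engine with a shared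
block (`LatticeRP.integral_splice_mul_conj_comp_of_shared_nonneg`).  This file redoes the algebra of
`CrossingWeightRP` in that geometry: the weight configuration `crossWeightO` (a non-negative character
combination `Σ_n a_{p,n} χ_n` on the crossing plaquettes, the plaquette function `f_c` elsewhere) splits as
`G(U) G(ΘU) S(U) W_×(U)` with the SHARED weight `S(U) = ∏_{p ⊂ slice m+1} f_c(U_p)`; when `f_c ≥ 0` POINTWISE
(the hypothesis that "planes with sites" cost — automatic for Tomboulis's `f = e^{A_p}/F_0 > 0`, and on the
census's one-character ray exactly `c_{1/2} ≤ 1/4`) `S = √S · √S` is absorbed symmetrically into the two halves,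
and every crossing character kernel is an integral Gram form (`charKernel_eq_integral` of `CharacterTwistGram`).
The analysis (continuity, Fubini, positivity) is in `OddCrossingBound`.

## Main definitions and statements (namespace `Summit.Ventures.YMGap.Census`)

* `crossWeightO`, `crossIntegralO`; `gPosO`, `gShO`, `sqShO`; `prod_crossWeightO_split`, `gShO_eq_sqShO_mul`.
* `gWtO`, `featO`, `plaqRe_translateLow_eq_two_mul_su2a0`, `cross_factorO`, `wCrossO_translateLow`.
* `PhiO`, `MintO`, `gPosO_congr`, `sqShO_congr`, `featO_congr`, `dependsOn_PhiO`.

References: E. T. Tomboulis, arXiv:0707.2179, §2 (2.8), Prop. II.1, Prop. IV.1, App. A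
[cite: Tomboulis2007Confinement, §2 eq. (2.8); App. A]; K. Osterwalder, E. Seiler, Ann. Phys. 110 (1978) 440, §2
[cite: OsterwalderSeilerAnnPhys1978, §2]; J. Fröhlich, R. Israel, E. H. Lieb, B. Simon, Comm. Math. Phys. 62
(1978) 1, Thm. 2.1 (reflection through sites) [cite: FrohlichIsraelLiebSimon1978, Thm. 2.1].
-/

noncomputable section

open MeasureTheory Finset Real
open scoped BigOperators ComplexConjugate
open Literature.MathematicalPhysics.QuantumLattice
open Literature.MathematicalPhysics.QuantumFieldTheory
open Literature.MathematicalPhysics.QuantumFieldTheory.Tomboulis2007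
open Literature.MathematicalPhysics.QuantumFieldTheory.WilsonRP
open Literature.MathematicalPhysics.QuantumFieldTheory.WilsonOddRP
open Summit.Ventures.LatticeQCDFlow.Exactness
open Summit.Ventures.LatticeQCDFlow.Scoring

namespace Summit.Ventures.YMGap.Census

variable {d L : ℕ}

section ORP

variable [NeZero d] [NeZero L] [Fact (1 < L)]

/-! ### The weight configuration, the split `G(U) G(ΘU) S(U) W_×(U)` -/

/-- The weight of plaquette `p` on the odd torus: the character sum `charSum J (a p)` on the crossing plaquettes
(temporal plaquettes based in the slice `t = 0`, `WilsonOddRP.IsOCrossPlaq`), the plaquette function `f` elsewhere. -/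
def crossWeightO (J : ℕ) (c : ℕ → ℝ) (a : Plaquette d L → ℕ → ℝ) (p : Plaquette d L) (r : ℝ) : ℝ :=
  if IsOCrossPlaq p then charSum J (a p) r else fR J c r

/-- `∫ ∏_p crossWeightO_p(Re tr U_p) dU`. -/
def crossIntegralO (J : ℕ) (c : ℕ → ℝ) (a : Plaquette d L → ℕ → ℝ) : ℝ :=
  ∫ W, ∏ p, crossWeightO J c a p (plaqRe rhoFund W p) ∂(LatticeRP.piMeasure (haarProbability SU2))

/-- The positive part `G(W) = ∏_{p positive} f(U_p)` (base point in the slices `1 ≤ t ≤ m`). -/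
def gPosO (J : ℕ) (c : ℕ → ℝ) (W : GaugeConfig d L SU2) : ℝ :=
  ∏ p ∈ univ.filter IsOPosPlaq, fR J c (plaqRe rhoFund W p)

/-- The shared part `S(W) = ∏_{p shared} f(U_p)` (spatial plaquettes inside the site hyperplane `t = m+1`). -/
def gShO (J : ℕ) (c : ℕ → ℝ) (W : GaugeConfig d L SU2) : ℝ :=
  ∏ p ∈ univ.filter IsOSharedPlaq, fR J c (plaqRe rhoFund W p)

/-- The square root of the shared part, `√S(W) = ∏_{p shared} √f(U_p)`. -/
def sqShO (J : ℕ) (c : ℕ → ℝ) (W : GaugeConfig d L SU2) : ℝ :=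
  ∏ p ∈ univ.filter IsOSharedPlaq, Real.sqrt (fR J c (plaqRe rhoFund W p))

/-- The negative plaquettes are the reflected positive ones (odd torus). -/
theorem prod_neg_eq_prod_pos_timeReflect_odd (hL : Odd L) (φ : ℝ → ℝ) (W : GaugeConfig d L SU2) :
    ∏ p ∈ univ.filter IsONegPlaq, φ (plaqRe rhoFund W p) =
      ∏ p ∈ univ.filter IsOPosPlaq, φ (plaqRe rhoFund W.timeReflect p) := by
  simp_rw [plaqRe_timeReflect rhoFund (continuous_fundamentalRep (Fin 2))]
  symm
  refine Finset.prod_equiv plaqReflectEquiv (fun p => ?_) (fun p _ => rfl)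
  simp only [Finset.mem_filter, Finset.mem_univ, true_and]
  exact (isONegPlaq_plaqReflect_iff hL p).symm

/-- **The split `∏_p w_p(U) = G(U) G(ΘU) S(U) ∏_{p crossing} charSum_p(U_p)`** on the odd torus. -/
theorem prod_crossWeightO_split (hL : Odd L) (J : ℕ) (c : ℕ → ℝ) (a : Plaquette d L → ℕ → ℝ)
    (W : GaugeConfig d L SU2) :
    ∏ p : Plaquette d L, crossWeightO J c a p (plaqRe rhoFund W p) =
      gPosO J c W * gPosO J c W.timeReflect * gShO J c W *
        ∏ p ∈ univ.filter IsOCrossPlaq, charSum J (a p) (plaqRe rhoFund W p) := by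
  rw [← Finset.prod_filter_mul_prod_filter_not univ IsOCrossPlaq, mul_comm]
  congr 1
  · have hw : ∀ p ∈ univ.filter (fun p => ¬ IsOCrossPlaq p),
        crossWeightO J c a p (plaqRe rhoFund W p) = fR J c (plaqRe rhoFund W p) := fun p hp => by
      simp [crossWeightO, (Finset.mem_filter.mp hp).2]
    rw [Finset.prod_congr rfl hw,
      ← Finset.prod_filter_mul_prod_filter_not (univ.filter fun p => ¬ IsOCrossPlaq p) IsOPosPlaq,
      Finset.filter_filter, Finset.filter_filter]
    have hpos : univ.filter (fun p : Plaquette d L => ¬ IsOCrossPlaq p ∧ IsOPosPlaq p) = univ.filter IsOPosPlaq :=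
      Finset.filter_congr fun p _ =>
        ⟨fun h => h.2, fun h => ⟨fun hc => not_isOPosPlaq_of_isOCrossPlaq hc h, h⟩⟩
    rw [hpos, ← Finset.prod_filter_mul_prod_filter_not
        (univ.filter fun p : Plaquette d L => ¬ IsOCrossPlaq p ∧ ¬ IsOPosPlaq p) IsOSharedPlaq,
      Finset.filter_filter, Finset.filter_filter]
    have hsh : univ.filter (fun p : Plaquette d L => (¬ IsOCrossPlaq p ∧ ¬ IsOPosPlaq p) ∧ IsOSharedPlaq p) =
        univ.filter IsOSharedPlaq :=
      Finset.filter_congr fun p _ =>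
        ⟨fun h => h.2, fun h => ⟨⟨(not_isOPosPlaq_of_isOSharedPlaq h).2, (not_isOPosPlaq_of_isOSharedPlaq h).1⟩, h⟩⟩
    have hneg : univ.filter (fun p : Plaquette d L => (¬ IsOCrossPlaq p ∧ ¬ IsOPosPlaq p) ∧ ¬ IsOSharedPlaq p) =
        univ.filter IsONegPlaq :=
      Finset.filter_congr fun p _ => by unfold IsONegPlaq; tauto
    rw [hsh, hneg, prod_neg_eq_prod_pos_timeReflect_odd hL (fR J c) W]
    unfold gPosO gShO
    ring
  · exact Finset.prod_congr rfl fun p hp => by simp [crossWeightO, (Finset.mem_filter.mp hp).2]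

omit [Fact (1 < L)] in
/-- **`S = √S · √S` when `f ≥ 0` pointwise** (the hypothesis that reflection through sites costs). -/
theorem gShO_eq_sqShO_mul (J : ℕ) {c : ℕ → ℝ} (hf : ∀ U : SU2, 0 ≤ plaqFn J c U) (W : GaugeConfig d L SU2) :
    gShO J c W = sqShO J c W * sqShO J c W := by
  unfold gShO sqShO
  rw [← Finset.prod_mul_distrib]
  refine Finset.prod_congr rfl fun p _ => ?_
  rw [Real.mul_self_sqrt]
  rw [← plaqFn_hol_eq_fR]
  exact hf _

/-! ### The crossing character kernels as integral Gram forms -/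

/-- The Gram weights: `a_p(n) · (n+1)` on crossing plaquettes, `[n = 0]` elsewhere. -/
def gWtO (a : Plaquette d L → ℕ → ℝ) (p : Plaquette d L) (n : ℕ) : ℝ :=
  if IsOCrossPlaq p then a p n * ((n : ℝ) + 1) else (if n = 0 then 1 else 0)

omit [NeZero L] [Fact (1 < L)] in
/-- The Gram weights are non-negative when `a ≥ 0`. -/
theorem gWtO_nonneg {a : Plaquette d L → ℕ → ℝ} (ha : ∀ p n, 0 ≤ a p n) (p : Plaquette d L) (n : ℕ) :
    0 ≤ gWtO a p n := by
  unfold gWtO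
  split_ifs
  · exact mul_nonneg (ha p n) (by positivity)
  · exact zero_le_one
  · exact le_rfl

/-- The features: `U_n(a₀(ω_p(W) R))` for a crossing plaquette (`ω_p = WilsonRP.halfPlaq`, `R ∈ SU(2)` the
auxiliary convolution variable), the constant `1` elsewhere. -/
def featO (p : Plaquette d L) (n : ℕ) (R : SU2) (W : GaugeConfig d L SU2) : ℝ :=
  if IsOCrossPlaq p then (Polynomial.Chebyshev.U ℝ (n : ℤ)).eval (su2a0 (halfPlaq p W * R)) else 1

/-- **The crossing identity for `Re tr` on the odd torus**: `Re tr (translateLow Y U)_p = 2 a₀(ω_p(z) ω_p(ΘU)⁻¹)`,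
`z = splice_C(U, Y)` (`WilsonOddRP.plaqRe_translateLow_of_isOCrossPlaq`, the unitarian sum folded back). -/
theorem plaqRe_translateLow_eq_two_mul_su2a0 (hL : Odd L) (W Y : GaugeConfig d L SU2) {p : Plaquette d L}
    (hp : IsOCrossPlaq p) :
    plaqRe rhoFund (translateLow Y W) p =
      2 * su2a0 (halfPlaq p (LatticeRP.splice lowerEdges (W, Y)) * (halfPlaq p W.timeReflect)⁻¹) := by
  rw [plaqRe_translateLow_of_isOCrossPlaq rhoFund hL (continuous_fundamentalRep (Fin 2)) W Y hp,
    ← Literature.RepresentationTheory.CompactGroups.CompactGroup.re_trace_mul_inv_eq_sum rhoFund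
      (continuous_fundamentalRep (Fin 2))]
  simp only [su2a0, fundamentalRep_apply]
  ring

/-- **The Gram identity for one plaquette**: after `translateLow Y` the factor of a crossing plaquette is
`Σ_n gWtO_p(n) ∫ featO_{p,n}(R, z) featO_{p,n}(R, ΘU) dR`; the trivial factor of a non-crossing plaquette has the
same form. -/
theorem cross_factorO (hL : Odd L) (J : ℕ) (a : Plaquette d L → ℕ → ℝ) (W Y : GaugeConfig d L SU2)
    (p : Plaquette d L) :
    (if IsOCrossPlaq p then charSum J (a p) (plaqRe rhoFund (translateLow Y W) p) else 1) =
      ∑ n ∈ Finset.range (J + 1), gWtO a p n *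
        ∫ R, featO p n R (LatticeRP.splice lowerEdges (W, Y)) * featO p n R W.timeReflect
          ∂(haarProbability SU2) := by
  by_cases hp : IsOCrossPlaq p
  · rw [if_pos hp]
    unfold charSum
    refine Finset.sum_congr rfl fun n _ => ?_
    have hr : charR n (plaqRe rhoFund (translateLow Y W) p) =
        (Polynomial.Chebyshev.U ℝ (n : ℤ)).eval
          (su2a0 (halfPlaq p (LatticeRP.splice lowerEdges (W, Y)) * (halfPlaq p W.timeReflect)⁻¹)) := by
      rw [charR, plaqRe_translateLow_eq_two_mul_su2a0 hL W Y hp, mul_div_cancel_left₀ _ two_ne_zero]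
    simp only [gWtO, featO, if_pos hp]
    rw [hr, charKernel_eq_integral]
    ring
  · rw [if_neg hp]
    simp [gWtO, featO, hp]

/-- The crossing product after `translateLow Y`:
`∏_{p crossing} charSum_p = Σ_x Γ_x ∫_{R⃗} Ψ_x(z, R⃗) Ψ_x(ΘU, R⃗) dR⃗`. -/
theorem wCrossO_translateLow (hL : Odd L) (J : ℕ) (a : Plaquette d L → ℕ → ℝ) (W Y : GaugeConfig d L SU2) :
    ∏ p ∈ univ.filter IsOCrossPlaq, charSum J (a p) (plaqRe rhoFund (translateLow Y W) p) =
      ∑ x ∈ Fintype.piFinset (fun _ : Plaquette d L => Finset.range (J + 1)),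
        (∏ p, gWtO a p (x p)) *
          ∫ Rv, (∏ p, featO p (x p) (Rv p) (LatticeRP.splice lowerEdges (W, Y))) *
            (∏ p, featO p (x p) (Rv p) W.timeReflect)
            ∂(Measure.pi fun _ : Plaquette d L => haarProbability SU2) := by
  rw [Finset.prod_filter, Finset.prod_congr rfl fun p _ => cross_factorO hL J a W Y p, Finset.prod_univ_sum]
  refine Finset.sum_congr rfl fun x _ => ?_
  rw [Finset.prod_mul_distrib]
  congr 1
  rw [← integral_fintype_prod_eq_prod
    (fun p R => featO p (x p) R (LatticeRP.splice lowerEdges (W, Y)) * featO p (x p) R W.timeReflect)]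
  refine integral_congr_ae (ae_of_all _ fun Rv => ?_)
  simp only [Finset.prod_mul_distrib]

/-! ### The observable `Φ_{x,R⃗} = G · √S · ∏ featO` and the tripled integrand -/

/-- `Φ_{x,R⃗}(W) = G(W) √S(W) ∏_p featO_{p, x_p}(R⃗_p, W)`. -/
def PhiO (J : ℕ) (c : ℕ → ℝ) (x : Plaquette d L → ℕ) (Rv : Plaquette d L → SU2)
    (W : GaugeConfig d L SU2) : ℝ :=
  gPosO J c W * sqShO J c W * ∏ p, featO p (x p) (Rv p) W

/-- The tripled integrand `M((U, Y), R⃗) = Σ_x Γ_x Φ_{x,R⃗}(splice_C(U, Y)) Φ_{x,R⃗}(ΘU)`. -/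
def MintO (J : ℕ) (c : ℕ → ℝ) (a : Plaquette d L → ℕ → ℝ)
    (q : GaugeConfig d L SU2 × GaugeConfig d L SU2) (Rv : Plaquette d L → SU2) : ℝ :=
  ∑ x ∈ Fintype.piFinset (fun _ : Plaquette d L => Finset.range (J + 1)),
    (∏ p, gWtO a p (x p)) *
      (PhiO J c x Rv (LatticeRP.splice lowerEdges q) * PhiO J c x Rv (GaugeConfig.timeReflect q.1))

/-- `G` depends only on the positive and shared links. -/
theorem gPosO_congr (hL : Odd L) (J : ℕ) (c : ℕ → ℝ) {A B : GaugeConfig d L SU2}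
    (hAB : ∀ e : Edge d L, IsOPosEdge e ∨ IsOSharedEdge e → A e = B e) :
    gPosO J c A = gPosO J c B := by
  unfold gPosO
  refine Finset.prod_congr rfl fun p hp => ?_
  obtain ⟨h1, h2, h3, h4⟩ := edges_of_isOPosPlaq hL (Finset.mem_filter.mp hp).2
  simp only [plaqRe, plaquetteHolonomy, hAB _ h1, hAB _ h2, hAB _ h3, hAB _ h4]

omit [Fact (1 < L)] in
/-- `√S` depends only on the shared links. -/
theorem sqShO_congr (J : ℕ) (c : ℕ → ℝ) {A B : GaugeConfig d L SU2}
    (hAB : ∀ e : Edge d L, IsOSharedEdge e → A e = B e) :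
    sqShO J c A = sqShO J c B := by
  unfold sqShO
  refine Finset.prod_congr rfl fun p hp => ?_
  obtain ⟨h1, h2, h3, h4⟩ := edges_of_isOSharedPlaq (Finset.mem_filter.mp hp).2
  simp only [plaqRe, plaquetteHolonomy, hAB _ h1, hAB _ h2, hAB _ h3, hAB _ h4]

/-- The features depend only on the links in `P ∪ C ∪ M`. -/
theorem featO_congr (hL : Odd L) (p : Plaquette d L) (n : ℕ) (R : SU2) {A B : GaugeConfig d L SU2}
    (hAB : ∀ e ∈ ((oPosEdges ∪ lowerEdges ∪ oSharedEdges : Finset (Edge d L)) : Set (Edge d L)), A e = B e) :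
    featO p n R A = featO p n R B := by
  unfold featO
  split_ifs with hp
  · rw [halfPlaq_congr_odd hL hp hAB]
  · rfl

/-- `Φ_{x,R⃗}` depends only on the links in `P ∪ C ∪ M`. -/
theorem dependsOn_PhiO (hL : Odd L) (J : ℕ) (c : ℕ → ℝ) (x : Plaquette d L → ℕ)
    (Rv : Plaquette d L → SU2) :
    DependsOn (PhiO J c x Rv)
      ((oPosEdges ∪ lowerEdges ∪ oSharedEdges : Finset (Edge d L)) : Set (Edge d L)) := by
  intro A B hAB
  have hPM : ∀ e : Edge d L, IsOPosEdge e ∨ IsOSharedEdge e → A e = B e := fun e he =>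
    hAB e (by rcases he with he | he <;> simp [he])
  have hM : ∀ e : Edge d L, IsOSharedEdge e → A e = B e := fun e he => hAB e (by simp [he])
  unfold PhiO
  rw [gPosO_congr hL J c hPM, sqShO_congr J c hM,
    Finset.prod_congr rfl fun p _ => featO_congr hL p (x p) (Rv p) hAB]

end ORP

end Summit.Ventures.YMGap.Census

end
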